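import Summits.AtomisticToContinuum.BoseEinsteinCondensation.Theses.BECCellInformation
import Summits.AtomisticToContinuum.BoseEinsteinCondensation.Theorems.BECCellInformationCellInformationBoundStubVarianceToInformation

/-!
# Crux `CellInformationBound` (stmt-AtomisticToContinuum-13439) — birth skeleton `Lines/birth.lean`

Route: `route-AtomisticToContinuum-BECCellInformation` (sub-problem `BoseEinsteinCondensation`),
crux decl `Summit.AtomisticToContinuum.BoseEinsteinCondensation.Theses.BECCellInformation.CellInformationBound` (rank 2, THE BET of the route):
the N-uniform bound on the COARSE MUTUAL INFORMATION `I(cell_l(x₁) ; (x₂,…,x_N)) ≤ C` for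
non-negative `δ`-near-minimisers of the dilute Dirichlet Bose gas, typed as
`∫ dY Σ_k m(Y) P_k klFun(A_k(Y) / (m(Y) P_k)) ≤ C` with `A_k(Y) = ∫_(cell k) |Ψ(x,Y)|² dx`,
`m(Y) = ∫ |Ψ(z,Y)|² dz`, `P_k = ∫ A_k(Y') dY'` (cells of side `L/M`, `M = ⌈L/l⌉₊`).

## The line (the route header's foreseen glued split, TWO-LAYER PLAN: "CellInformationBound ⇐
InsertionFieldCellVariance → VarianceToInformation")

Information is dominated by variance.  Pointwise in `Y`, the mutual-information integrand is
`m(Y) · KL(Q(·|Y) ‖ P)` with `Q(k|Y) = A_k(Y)/m(Y)` the law of the tagged boson's cell given all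
the other bosons, and `KL ≤ log(1 + χ²) ≤ χ²`; so the crux follows from an N-uniform bound on the
`χ²`-MUTUAL INFORMATION
  `E_Y χ²(Q(·|Y) ‖ P) = ∫ dY Σ_k (A_k(Y) − m(Y) P_k)² / (m(Y) P_k) = Σ_k Var_m(Q_k) / P_k`,
i.e. on the RELATIVE VARIANCE ACROSS CELLS OF THE CELL-INTEGRATED CONDITIONAL INTENSITY (the
"insertion field" `e^(−W)` of Reatto's test-particle picture, averaged over a cell of side `l`).
This is a quadratic (second-moment) statistic of the N-body density `|Ψ|²` — the natural target of
variance / sum-rule / structure-factor technology (heuristic value `σ_l² = ρ∫|φ̂_eff|²|ĝ_l|²S(k)d³k/(2π)³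
= O(√(ρa³)) + O((ξ/l)²)`, infrared-finite exactly when `d ≥ 2`; `MI ≈ ½χ²` in the small-fluctuation
regime `ρl³ ≫ 1`), whereas the entropy itself has no second-moment expression.

* `stub_cellVarianceBound` (InsertionFieldCellVariance; the hard stub, open-problem strength, same
  quantifier frame as the crux): `E_Y χ² ≤ C` for all non-negative `δ`-near-minimisers, `l, C` before
  `N`, `δ` after.  [Reatto1969, ReattoChester1967, GhoshLebowitz2017, GavalakisKontoyiannis2021]
* `stub_varianceToInformation` (VarianceToInformation; LANDED 2026-08-17 by lead c1 wave 1, p143411, as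
  `Summit.AtomisticToContinuum.BoseEinsteinCondensation.Theorems.CellInformationBound.stub_varianceToInformation`):
  for EVERY trial state and every cell grid, `∫ dY Σ_k m P_k klFun(A_k/(m P_k)) ≤ ∫ dY Σ_k (A_k − m P_k)²/(m P_k)`
  — termwise `D·klFun(a/D) ≤ (a − D)²/D` for `a, D ≥ 0` (`klFun t ≤ (t−1)²`, i.e. `log t ≤ t − 1`;
  both sides are `0` at `D = 0` with Lean's `x/0 = 0`, `klFun 0 = 1`), then `Finset.sum_le_sum`,
  `ENNReal.ofReal_le_ofReal`, `lintegral_mono`.  [CoverThomas2005 Lemma 11.6.1-type bound `KL ≤ χ²`;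
  Mathlib `InformationTheory.klFun`, `Real.log_le_sub_one_of_pos`]
* `CellInformationBound_of : CellInformationBound` (route decl BY NAME, stubs used BY NAME): the
  quantifier plumbing (`ρ₀, l, C, δ` of the variance bound, then `le_trans` with the fixed-state
  inequality) — no `sorry` of its own; the preceding `example` is the same composition in hypothesis
  form `stubA-sig → stubB-sig → CellInformationBound`, sorry-free (axioms propext / Classical.choice /
  Quot.sound).

Disproof used: none exists yet for this crux (`ledger crux ls stmt-AtomisticToContinuum-13439`: no
`Disproof.lean`, 2026-08-17); negatives index (`ledger negatives --problem AtomisticToContinuum`, 20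
entries) has no cell-variance / mutual-information statement; the only BEC negatives
(`BECSwapAffinitySwapJensen_refuted`, `BECPopovBerryRGBerryStiffPhaseLRO_refuted`) are not instances
of either stub (the `C < 0` lesson of SwapJensen does not arise: both stubs are `≤` bounds with `∃ C`).
-/

namespace Summit.AtomisticToContinuum.BoseEinsteinCondensation.Cruxes.CellInformationBound.Birth

open scoped BigOperators Topology Manifold Classical MeasureTheory ProbabilityTheory Matrix InnerProductSpace ComplexConjugate ContinuousMap
open Filter Set Function TopologicalSpace MeasureTheory


/-- **stub A — `InsertionFieldCellVariance` (χ²-mutual information / relative cell variance bound).**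
For every repulsive finite-range `v` there is `ρ₀ > 0` such that for `0 < ρ < ρ₀` there are a cell
side `l > 0` and `C` with: for all large `N = n+1` there is `δ > 0` such that every non-negative
`δ`-near-minimiser `Ψ` of the Dirichlet energy in the box of side `L = (N/ρ)^(1/3)` has
`∫ dY Σ_k (A_k(Y) − m(Y) P_k)² / (m(Y) P_k) ≤ C` (`= E_Y χ²(Q(·|Y) ‖ P) = Σ_k Var_m(Q_k)/P_k`, the
relative variance across the `M³` cells of side `L/M ≤ l` of the cell-integrated conditional
intensity of the tagged boson given the other `N − 1`).  Heuristic value `σ_l² = O(√(ρa³)) + O((ξ/l)²)`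
(Bogoliubov structure factor `S(k) ~ k`, Reatto–Chester `1/r²` tail; free gas: `0`); `log N` growth
would mean number rigidity of `|Ψ₀|²` at scale `l` (true in `d = 1`).  Why it might fail: as the crux
(it is stronger by `KL ≤ χ²`, with the same heuristic order `MI ≈ ½χ²` for `ρl³ ≫ 1`); additionally a
heavy upper tail of `Q_k/P_k` (a boson caged into one cell by the others) is weighted linearly here,
logarithmically in the crux — excluded heuristically only by the super-exponential cost of caging.
Size: open-problem (the physics of the crux).
[cite: Reatto1969; ReattoChester1967; GhoshLebowitz2017; GavalakisKontoyiannis2021; LSSY2005 Ch. 2] -/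
theorem stub_cellVarianceBound :
    ∀ v : ℝ → ENNReal, Literature.MathematicalPhysics.QuantumManyBody.BoseGas.IsRepulsiveFiniteRange v → ∃ ρ₀ : ℝ, 0 < ρ₀ ∧ ∀ ρ : ℝ, 0 < ρ → ρ < ρ₀ → ∃ l : ℝ, 0 < l ∧ ∃ C : ℝ, ∀ᶠ n : ℕ in Filter.atTop, ∃ δ : ENNReal, 0 < δ ∧ ∀ Ψ : Literature.MathematicalPhysics.QuantumManyBody.BoseGas.TrialState (n + 1) (Literature.MathematicalPhysics.QuantumManyBody.BoseGas.sideLength ρ (n + 1)), Literature.MathematicalPhysics.QuantumManyBody.BoseGas.energy v Ψ ≤ Literature.MathematicalPhysics.QuantumManyBody.BoseGas.groundStateEnergy v (n + 1) (Literature.MathematicalPhysics.QuantumManyBody.BoseGas.sideLength ρ (n + 1)) + δ → (∀ X, Ψ.ψ X = (‖Ψ.ψ X‖ : ℂ)) → ∫⁻ Y : Literature.MathematicalPhysics.QuantumManyBody.BoseGas.Config n, ENNReal.ofReal (∑ k : Fin 3 → Fin ⌈Literature.MathematicalPhysics.QuantumManyBody.BoseGas.sideLength ρ (n + 1) / l⌉₊,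 ((∫ x in {y : EuclideanSpace ℝ (Fin 3) | ∀ j, y j ∈ Set.Ico (((k j : ℕ) : ℝ) * (Literature.MathematicalPhysics.QuantumManyBody.BoseGas.sideLength ρ (n + 1) / (⌈Literature.MathematicalPhysics.QuantumManyBody.BoseGas.sideLength ρ (n + 1) / l⌉₊ : ℝ))) ((((k j : ℕ) : ℝ) + 1) * (Literature.MathematicalPhysics.QuantumManyBody.BoseGas.sideLength ρ (n + 1) / (⌈Literature.MathematicalPhysics.QuantumManyBody.BoseGas.sideLength ρ (n + 1) / l⌉₊ : ℝ)))}, ‖Ψ.ψ (Matrix.vecCons x Y)‖ ^ 2) - (∫ z, ‖Ψ.ψ (Matrix.vecCons z Y)‖ ^ 2) * (∫ Y' : Literature.MathematicalPhysics.QuantumManyBody.BoseGas.Config n, ∫ x in {y : EuclideanSpace ℝ (Fin 3) | ∀ j, y j ∈ Set.Ico (((k j : ℕ) : ℝ) * (Literature.MathematicalPhysics.QuantumManyBody.BoseGas.sideLength ρ (n + 1) / (⌈Literature.MathematicalPhysics.QuantumManyBody.BoseGas.sideLength ρ (n + 1) / l⌉₊ : ℝ))) ((((k j : ℕ) : ℝ)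 + 1) * (Literature.MathematicalPhysics.QuantumManyBody.BoseGas.sideLength ρ (n + 1) / (⌈Literature.MathematicalPhysics.QuantumManyBody.BoseGas.sideLength ρ (n + 1) / l⌉₊ : ℝ)))}, ‖Ψ.ψ (Matrix.vecCons x Y')‖ ^ 2)) ^ 2 / ((∫ z, ‖Ψ.ψ (Matrix.vecCons z Y)‖ ^ 2) * (∫ Y' : Literature.MathematicalPhysics.QuantumManyBody.BoseGas.Config n, ∫ x in {y : EuclideanSpace ℝ (Fin 3) | ∀ j, y j ∈ Set.Ico (((k j : ℕ) : ℝ) * (Literature.MathematicalPhysics.QuantumManyBody.BoseGas.sideLength ρ (n + 1) / (⌈Literature.MathematicalPhysics.QuantumManyBody.BoseGas.sideLength ρ (n + 1) / l⌉₊ : ℝ))) ((((k j : ℕ) : ℝ) + 1) * (Literature.MathematicalPhysics.QuantumManyBody.BoseGas.sideLength ρ (n + 1) / (⌈Literature.MathematicalPhysics.QuantumManyBody.BoseGas.sideLength ρ (n + 1) / l⌉₊ : ℝ)))}, ‖Ψ.ψ (Matrix.vecCons x Y')‖ ^ 2))) ≤ ENNReal.ofReal C := by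
  sorry

/-- **stub B — `VarianceToInformation` (`KL ≤ χ²` for the cell functionals, every trial state).**
For every `n, L, M` and every trial state `Ψ ∈ TrialState (n+1) L`, with cells of side `L/M`:
`∫ dY Σ_k m(Y) P_k klFun(A_k(Y)/(m(Y) P_k)) ≤ ∫ dY Σ_k (A_k(Y) − m(Y) P_k)²/(m(Y) P_k)` as lower
Lebesgue integrals of `ENNReal.ofReal` of the finite sums.  Proof route: termwise, for `a = A_k(Y) ≥ 0`
and `D = m(Y) P_k ≥ 0`, `D · klFun(a/D) ≤ D (a/D − 1)² = (a − D)²/D` when `D > 0` (`klFun t ≤ (t − 1)²`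
for `t ≥ 0`, from `log t ≤ t − 1`), and both sides vanish when `D = 0` (`x / 0 = 0`, `0 · klFun _ = 0`);
then `Finset.sum_le_sum`, `ENNReal.ofReal_le_ofReal`, `MeasureTheory.lintegral_mono`.  No positivity,
normalisation, `L > 0` or `M > 0` is needed.  Size S–M (provable now).
[cite: CoverThomas2005, Lemma 11.6.1 (`D(P‖Q) ≤ χ²(P‖Q)` via `log x ≤ x − 1`); Mathlib
`InformationTheory.klFun`, `Real.log_le_sub_one_of_pos`] -/
theorem stub_varianceToInformation :
    ∀ (n : ℕ) (L : ℝ) (M : ℕ) (Ψ : Literature.MathematicalPhysics.QuantumManyBody.BoseGas.TrialState (n + 1) L), ∫⁻ Y : Literature.MathematicalPhysics.QuantumManyBody.BoseGas.Config n, ENNReal.ofReal (∑ k : Fin 3 → Fin M, (∫ z, ‖Ψ.ψ (Matrix.vecCons z Y)‖ ^ 2) * (∫ Y' : Literature.MathematicalPhysics.QuantumManyBody.BoseGas.Config n, ∫ x in {y : EuclideanSpace ℝ (Fin 3) | ∀ j, y j ∈ Set.Ico (((k j : ℕ) : ℝ) * (L / (M : ℝ))) ((((k j : ℕ) : ℝ)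 + 1) * (L / (M : ℝ)))}, ‖Ψ.ψ (Matrix.vecCons x Y')‖ ^ 2) * InformationTheory.klFun ((∫ x in {y : EuclideanSpace ℝ (Fin 3) | ∀ j, y j ∈ Set.Ico (((k j : ℕ) : ℝ) * (L / (M : ℝ))) ((((k j : ℕ) : ℝ) + 1) * (L / (M : ℝ)))}, ‖Ψ.ψ (Matrix.vecCons x Y)‖ ^ 2) / ((∫ z, ‖Ψ.ψ (Matrix.vecCons z Y)‖ ^ 2) * (∫ Y' : Literature.MathematicalPhysics.QuantumManyBody.BoseGas.Config n, ∫ x in {y : EuclideanSpace ℝ (Fin 3) | ∀ j, y j ∈ Set.Ico (((k j : ℕ) : ℝ) * (L / (M : ℝ))) ((((k j : ℕ) : ℝ) + 1) * (L / (M : ℝ)))}, ‖Ψ.ψ (Matrix.vecCons x Y')‖ ^ 2)))) ≤ ∫⁻ Y : Literature.MathematicalPhysics.QuantumManyBody.BoseGas.Config n, ENNReal.ofReal (∑ k : Fin 3 → Fin M, ((∫ x in {y : EuclideanSpace ℝ (Fin 3) | ∀ j, y j ∈ Set.Ico (((k j : ℕ) : ℝ) * (L / (M : ℝ))) ((((k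 j : ℕ) : ℝ) + 1) * (L / (M : ℝ)))}, ‖Ψ.ψ (Matrix.vecCons x Y)‖ ^ 2) - (∫ z, ‖Ψ.ψ (Matrix.vecCons z Y)‖ ^ 2) * (∫ Y' : Literature.MathematicalPhysics.QuantumManyBody.BoseGas.Config n, ∫ x in {y : EuclideanSpace ℝ (Fin 3) | ∀ j, y j ∈ Set.Ico (((k j : ℕ) : ℝ) * (L / (M : ℝ))) ((((k j : ℕ) : ℝ) + 1) * (L / (M : ℝ)))}, ‖Ψ.ψ (Matrix.vecCons x Y')‖ ^ 2)) ^ 2 / ((∫ z, ‖Ψ.ψ (Matrix.vecCons z Y)‖ ^ 2) * (∫ Y' : Literature.MathematicalPhysics.QuantumManyBody.BoseGas.Config n, ∫ x in {y : EuclideanSpace ℝ (Fin 3) | ∀ j, y j ∈ Set.Ico (((k j : ℕ) : ℝ) * (L / (M : ℝ))) ((((k j : ℕ) : ℝ) + 1) * (L / (M : ℝ)))}, ‖Ψ.ψ (Matrix.vecCons x Y')‖ ^ 2))) :=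
  -- LANDED (wave 1, p143411): Theorems/BECCellInformationCellInformationBoundStubVarianceToInformation.lean
  _root_.Summit.AtomisticToContinuum.BoseEinsteinCondensation.Theorems.CellInformationBound.stub_varianceToInformation

/-! ### Composition certificate (hypothesis form, sorry-free)

`example : <stub A signature> → <stub B signature> → CellInformationBound` — the pure implication,
kernel-checked here at every elaboration with NO `sorry` (the same term, as the named theorem
`CellInformationBound_of_hyp` of the seat's scratch file `bc/CellInformationBound_birth_hypform.lean`,
prints axioms `propext, Classical.choice, Quot.sound`).  It is an `example` (not a constant) so that
the skeleton audit sees exactly one theorem concluding the crux: `CellInformationBound_of` below. -/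
example :
    (∀ v : ℝ → ENNReal, Literature.MathematicalPhysics.QuantumManyBody.BoseGas.IsRepulsiveFiniteRange v → ∃ ρ₀ : ℝ, 0 < ρ₀ ∧ ∀ ρ : ℝ, 0 < ρ → ρ < ρ₀ → ∃ l : ℝ, 0 < l ∧ ∃ C : ℝ, ∀ᶠ n : ℕ in Filter.atTop, ∃ δ : ENNReal, 0 < δ ∧ ∀ Ψ : Literature.MathematicalPhysics.QuantumManyBody.BoseGas.TrialState (n + 1) (Literature.MathematicalPhysics.QuantumManyBody.BoseGas.sideLength ρ (n + 1)), Literature.MathematicalPhysics.QuantumManyBody.BoseGas.energy v Ψ ≤ Literature.MathematicalPhysics.QuantumManyBody.BoseGas.groundStateEnergy v (n + 1) (Literature.MathematicalPhysics.QuantumManyBody.BoseGas.sideLength ρ (n + 1)) + δ → (∀ X, Ψ.ψ X = (‖Ψ.ψ X‖ : ℂ)) → ∫⁻ Y : Literature.MathematicalPhysics.QuantumManyBody.BoseGas.Config n, ENNReal.ofReal (∑ k : Fin 3 → Fin ⌈Literature.MathematicalPhysics.QuantumManyBody.BoseGas.sideLength ρ (n + 1) / l⌉₊, ((∫ x in {y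 : EuclideanSpace ℝ (Fin 3) | ∀ j, y j ∈ Set.Ico (((k j : ℕ) : ℝ) * (Literature.MathematicalPhysics.QuantumManyBody.BoseGas.sideLength ρ (n + 1) / (⌈Literature.MathematicalPhysics.QuantumManyBody.BoseGas.sideLength ρ (n + 1) / l⌉₊ : ℝ))) ((((k j : ℕ) : ℝ) + 1) * (Literature.MathematicalPhysics.QuantumManyBody.BoseGas.sideLength ρ (n + 1) / (⌈Literature.MathematicalPhysics.QuantumManyBody.BoseGas.sideLength ρ (n + 1) / l⌉₊ : ℝ)))}, ‖Ψ.ψ (Matrix.vecCons x Y)‖ ^ 2) - (∫ z, ‖Ψ.ψ (Matrix.vecCons z Y)‖ ^ 2) * (∫ Y' : Literature.MathematicalPhysics.QuantumManyBody.BoseGas.Config n, ∫ x in {y : EuclideanSpace ℝ (Fin 3) | ∀ j, y j ∈ Set.Ico (((k j : ℕ) : ℝ) * (Literature.MathematicalPhysics.QuantumManyBody.BoseGas.sideLength ρ (n + 1) / (⌈Literature.MathematicalPhysics.QuantumManyBody.BoseGas.sideLength ρ (n + 1) / l⌉₊ : ℝ))) ((((k j : ℕ) : ℝ) + 1) * (Literature.MathematicalPhysics.QuantumManyBody.BoseGas.sideLength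 ρ (n + 1) / (⌈Literature.MathematicalPhysics.QuantumManyBody.BoseGas.sideLength ρ (n + 1) / l⌉₊ : ℝ)))}, ‖Ψ.ψ (Matrix.vecCons x Y')‖ ^ 2)) ^ 2 / ((∫ z, ‖Ψ.ψ (Matrix.vecCons z Y)‖ ^ 2) * (∫ Y' : Literature.MathematicalPhysics.QuantumManyBody.BoseGas.Config n, ∫ x in {y : EuclideanSpace ℝ (Fin 3) | ∀ j, y j ∈ Set.Ico (((k j : ℕ) : ℝ) * (Literature.MathematicalPhysics.QuantumManyBody.BoseGas.sideLength ρ (n + 1) / (⌈Literature.MathematicalPhysics.QuantumManyBody.BoseGas.sideLength ρ (n + 1) / l⌉₊ : ℝ))) ((((k j : ℕ) : ℝ) + 1) * (Literature.MathematicalPhysics.QuantumManyBody.BoseGas.sideLength ρ (n + 1) / (⌈Literature.MathematicalPhysics.QuantumManyBody.BoseGas.sideLength ρ (n + 1) / l⌉₊ : ℝ)))}, ‖Ψ.ψ (Matrix.vecCons x Y')‖ ^ 2))) ≤ ENNReal.ofReal C) →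
    (∀ (n : ℕ) (L : ℝ) (M : ℕ) (Ψ : Literature.MathematicalPhysics.QuantumManyBody.BoseGas.TrialState (n + 1) L), ∫⁻ Y : Literature.MathematicalPhysics.QuantumManyBody.BoseGas.Config n, ENNReal.ofReal (∑ k : Fin 3 → Fin M, (∫ z, ‖Ψ.ψ (Matrix.vecCons z Y)‖ ^ 2) * (∫ Y' : Literature.MathematicalPhysics.QuantumManyBody.BoseGas.Config n, ∫ x in {y : EuclideanSpace ℝ (Fin 3) | ∀ j, y j ∈ Set.Ico (((k j : ℕ) : ℝ) * (L / (M : ℝ))) ((((k j : ℕ) : ℝ) + 1) * (L / (M : ℝ)))}, ‖Ψ.ψ (Matrix.vecCons x Y')‖ ^ 2) * InformationTheory.klFun ((∫ x in {y : EuclideanSpace ℝ (Fin 3) | ∀ j, y j ∈ Set.Ico (((k j : ℕ) : ℝ) * (L / (M : ℝ))) ((((k j : ℕ) : ℝ) + 1) * (L / (M : ℝ)))}, ‖Ψ.ψ (Matrix.vecCons x Y)‖ ^ 2) / ((∫ z, ‖Ψ.ψ (Matrix.vecCons z Y)‖ ^ 2) * (∫ Y' : Literature.MathematicalPhysics.QuantumManyBody.BoseGas.Config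 n, ∫ x in {y : EuclideanSpace ℝ (Fin 3) | ∀ j, y j ∈ Set.Ico (((k j : ℕ) : ℝ) * (L / (M : ℝ))) ((((k j : ℕ) : ℝ) + 1) * (L / (M : ℝ)))}, ‖Ψ.ψ (Matrix.vecCons x Y')‖ ^ 2)))) ≤ ∫⁻ Y : Literature.MathematicalPhysics.QuantumManyBody.BoseGas.Config n, ENNReal.ofReal (∑ k : Fin 3 → Fin M, ((∫ x in {y : EuclideanSpace ℝ (Fin 3) | ∀ j, y j ∈ Set.Ico (((k j : ℕ) : ℝ) * (L / (M : ℝ))) ((((k j : ℕ) : ℝ) + 1) * (L / (M : ℝ)))}, ‖Ψ.ψ (Matrix.vecCons x Y)‖ ^ 2) - (∫ z, ‖Ψ.ψ (Matrix.vecCons z Y)‖ ^ 2) * (∫ Y' : Literature.MathematicalPhysics.QuantumManyBody.BoseGas.Config n, ∫ x in {y : EuclideanSpace ℝ (Fin 3) | ∀ j, y j ∈ Set.Ico (((k j : ℕ) : ℝ) * (L / (M : ℝ))) ((((k j : ℕ) : ℝ) + 1) * (L / (M : ℝ)))}, ‖Ψ.ψ (Matrix.vecCons x Y')‖ ^ 2))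 ^ 2 / ((∫ z, ‖Ψ.ψ (Matrix.vecCons z Y)‖ ^ 2) * (∫ Y' : Literature.MathematicalPhysics.QuantumManyBody.BoseGas.Config n, ∫ x in {y : EuclideanSpace ℝ (Fin 3) | ∀ j, y j ∈ Set.Ico (((k j : ℕ) : ℝ) * (L / (M : ℝ))) ((((k j : ℕ) : ℝ) + 1) * (L / (M : ℝ)))}, ‖Ψ.ψ (Matrix.vecCons x Y')‖ ^ 2)))) →
    Summit.AtomisticToContinuum.BoseEinsteinCondensation.Theses.BECCellInformation.CellInformationBound := by
  intro hA hB v hv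
  obtain ⟨ρ₀, hρ₀, H⟩ := hA v hv
  refine ⟨ρ₀, hρ₀, fun ρ hρ hρlt => ?_⟩
  obtain ⟨l, hl, C, hev⟩ := H ρ hρ hρlt
  refine ⟨l, hl, C, ?_⟩
  filter_upwards [hev] with n hn
  obtain ⟨δ, hδ, hΨ⟩ := hn
  exact ⟨δ, hδ, fun Ψ hE hpos => le_trans (hB n _ _ Ψ) (hΨ Ψ hE hpos)⟩

/-- **Assembly / skeleton theorem.** `CellInformationBound` (the route decl, BY NAME) from the two
declared stubs used BY NAME (fleet convention for registered lines, cf. `LandscapeBound_of`): take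
`ρ₀, l, C` and, eventually in `n`, `δ` from `stub_cellVarianceBound`; for a non-negative
`δ`-near-minimiser `Ψ` chain `stub_varianceToInformation n L M Ψ` (`L = sideLength ρ (n+1)`,
`M = ⌈L/l⌉₊`, fixed-state `KL ≤ χ²`) with the variance bound.  No `sorry` of its own (the only direct
`sorry`s of the file are the two stubs). -/
theorem CellInformationBound_of :
    Summit.AtomisticToContinuum.BoseEinsteinCondensation.Theses.BECCellInformation.CellInformationBound := by
  intro v hv
  obtain ⟨ρ₀, hρ₀, H⟩ := stub_cellVarianceBound v hv
  refine ⟨ρ₀, hρ₀, fun ρ hρ hρlt => ?_⟩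
  obtain ⟨l, hl, C, hev⟩ := H ρ hρ hρlt
  refine ⟨l, hl, C, ?_⟩
  filter_upwards [hev] with n hn
  obtain ⟨δ, hδ, hΨ⟩ := hn
  exact ⟨δ, hδ, fun Ψ hE hpos => le_trans (stub_varianceToInformation n _ _ Ψ) (hΨ Ψ hE hpos)⟩

end Summit.AtomisticToContinuum.BoseEinsteinCondensation.Cruxes.CellInformationBound.Birth
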